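import Mathlib
import Summits.AtomisticToContinuum.Crystallization.Theorems.PricedLinkCensusTruncatedCensusGapNearFirstShell

/-!
# The patch chart of a near-Barlow site

Helper file for the stub `stub_nearPricingEngine` (N3) of the line `near-far-split` of the crux
`PricedLinkCensus.TruncatedCensusGap` (item stmt-AtomisticToContinuum-14230), skeleton
`Cruxes/TruncatedCensusGap/Lines/near_far_split.lean`.

Near-Barlow data `(a, c, s, g)` at the site `i` of `y : Fin N → ℝ³` (the `3a`-patch of `y i` is
`a/2`-separated and two-way `a/50`-matched to `g '' barlowStacking a c s`) are packaged into a
**patch chart**: a map `Z` from the sites of the closed `3a`-patch to the stacking with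
`dist (y j) (g (Z j)) ≤ a/50`, injective on the patch, hitting every stacking point whose image
lies within `3a − a/50` of `y i`, and distorting mutual distances by at most `a/25`.  This is the
reference configuration against which the pricing engine expands the site energies of the patch
(displacements `u_j = g⁻¹ (y j) − Z j`, `‖u_j‖ ≤ a/50`).

* `nearBarlow_patchChart` — the chart with its four properties (binder form);
* `nearBarlow_patchChart_registered` — the registered one-line form.

Ingredients: `eq_of_matched_barlow`, `eq_of_matched_site` (file `…NearFirstShell`).
-/

noncomputable section

namespace Summit.AtomisticToContinuum.Crystallization.Theorems.PricedLinkCensusTruncatedCensusGap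

open scoped BigOperators Classical
open Literature.MathematicalPhysics.StatisticalMechanics

section PatchChart

variable {N : ℕ} {y : Fin N → EuclideanSpace ℝ (Fin 3)} {i : Fin N} {a c : ℝ} {s : ℤ → ℤ}
  {g : EuclideanSpace ℝ (Fin 3) ≃ᵃⁱ[ℝ] EuclideanSpace ℝ (Fin 3)}

/-- **The patch chart of a near-Barlow site.**  With near-Barlow data `(a, c, s, g)` at `i`
(`0 < a`, `0.78a ≤ c`; separation, forward and backward `a/50`-matching within `3a`) there is a
map `Z : Fin N → ℝ³` such that: (1) every site `j` of the closed `3a`-patch of `y i` has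
`Z j ∈ barlowStacking a c s` and `dist (y j) (g (Z j)) ≤ a/50`; (2) `Z` is injective on the patch;
(3) every stacking point whose `g`-image lies within `3a − a/50` of `y i` is `Z j` for a patch
site `j`; (4) for patch sites `j, k`, `|dist (y j) (y k) − dist (Z j) (Z k)| ≤ a/25`.
[folklore] -/
theorem nearBarlow_patchChart (ha : 0 < a) (hc1 : 78 / 100 * a ≤ c)
    (hsep : ∀ j k : Fin N, j ≠ k → dist (y j) (y i) ≤ 3 * a → a / 2 ≤ dist (y j) (y k))
    (hfwd : ∀ j : Fin N, dist (y j) (y i) ≤ 3 * a →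
      ∃ z ∈ barlowStacking a c s, dist (y j) (g z) ≤ a / 50)
    (hbwd : ∀ z ∈ barlowStacking a c s, dist (g z) (y i) ≤ 3 * a →
      ∃ j : Fin N, dist (y j) (g z) ≤ a / 50) :
    ∃ Z : Fin N → EuclideanSpace ℝ (Fin 3),
      (∀ j, dist (y j) (y i) ≤ 3 * a → Z j ∈ barlowStacking a c s ∧ dist (y j) (g (Z j)) ≤ a / 50) ∧
      (∀ j k, dist (y j) (y i) ≤ 3 * a → dist (y k) (y i) ≤ 3 * a → Z j = Z k → j = k) ∧
      (∀ z ∈ barlowStacking a c s, dist (g z) (y i) ≤ 3 * a - a / 50 →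
        ∃ j, dist (y j) (y i) ≤ 3 * a ∧ Z j = z) ∧
      (∀ j k, dist (y j) (y i) ≤ 3 * a → dist (y k) (y i) ≤ 3 * a →
        |dist (y j) (y k) - dist (Z j) (Z k)| ≤ a / 25) := by
  haveI : Nonempty (EuclideanSpace ℝ (Fin 3)) := ⟨0⟩
  choose! Z hZmem hZd using hfwd
  refine ⟨Z, fun j hj => ⟨hZmem j hj, hZd j hj⟩, ?_, ?_, ?_⟩
  · intro j k hj hk hjk
    have h1 := hZd j hj
    have h2 := hZd k hk
    rw [← hjk] at h2
    exact (eq_of_matched_site ha hsep hj h1 h2).symm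
  · intro z hz hzi
    obtain ⟨j, hj⟩ := hbwd z hz (by linarith)
    have hji : dist (y j) (y i) ≤ 3 * a := by
      linarith [dist_triangle (y j) (g z) (y i)]
    exact ⟨j, hji, eq_of_matched_barlow ha hc1 (hZmem j hji) hz (hZd j hji) hj⟩
  · intro j k hj hk
    have e : dist (Z j) (Z k) = dist (g (Z j)) (g (Z k)) := (g.dist_map _ _).symm
    rw [e, abs_le]
    have h1 := abs_dist_sub_le (y j) (g (Z j)) (y k)
    have h2 := abs_dist_sub_le (y k) (g (Z k)) (g (Z j))
    rw [abs_le] at h1 h2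
    rw [dist_comm (g (Z j)) (y k)] at h1
    rw [dist_comm (g (Z k)) (g (Z j))] at h2
    have h3 := hZd j hj
    have h4 := hZd k hk
    constructor <;> linarith [h1.1, h1.2, h2.1, h2.2]

end PatchChart

/-- **Patch chart of a near-Barlow site (registered form).** For near-Barlow data `(a, c, s, g)` at the site `i` of `y : Fin N → ℝ³` (`0 < a`, `0.78a ≤ c`, the `3a`-patch `a/2`-separated and two-way `a/50`-matched to `g '' barlowStacking a c s`) there is `Z : Fin N → ℝ³` mapping every site of the closed `3a`-patch to a stacking point with `dist (y j) (g (Z j)) ≤ a/50`, injective on the patch, onto the stacking points with image within `3a − a/50` of `y i`, and with `|dist (y j) (y k) − dist (Z j) (Z k)| ≤ a/25` on the patch. [folklore] -/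
theorem nearBarlow_patchChart_registered : ∀ (N : ℕ) (y : Fin N → EuclideanSpace ℝ (Fin 3)) (i : Fin N) (a c : ℝ) (s : ℤ → ℤ) (g : EuclideanSpace ℝ (Fin 3) ≃ᵃⁱ[ℝ] EuclideanSpace ℝ (Fin 3)), 0 < a → 78 / 100 * a ≤ c → (∀ j k : Fin N, j ≠ k → dist (y j) (y i) ≤ 3 * a → a / 2 ≤ dist (y j) (y k)) → (∀ j : Fin N, dist (y j) (y i) ≤ 3 * a → ∃ z ∈ Literature.MathematicalPhysics.StatisticalMechanics.barlowStacking a c s, dist (y j) (g z) ≤ a / 50) → (∀ z ∈ Literature.MathematicalPhysics.StatisticalMechanics.barlowStacking a c s, dist (g z) (y i) ≤ 3 * a → ∃ j : Fin N, dist (y j) (g z) ≤ a / 50) → ∃ Z : Fin N → EuclideanSpace ℝ (Fin 3), (∀ j : Fin N, dist (y j) (y i) ≤ 3 * a → Z j ∈ Literature.MathematicalPhysics.StatisticalMechanics.barlowStacking a c s ∧ dist (y j) (g (Z j)) ≤ a / 50) ∧ (∀ j k : Fin N, dist (y j) (y i) ≤ 3 * a → dist (y k) (y i) ≤ 3 *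 a → Z j = Z k → j = k) ∧ (∀ z ∈ Literature.MathematicalPhysics.StatisticalMechanics.barlowStacking a c s, dist (g z) (y i) ≤ 3 * a - a / 50 → ∃ j : Fin N, dist (y j) (y i) ≤ 3 * a ∧ Z j = z) ∧ (∀ j k : Fin N, dist (y j) (y i) ≤ 3 * a → dist (y k) (y i) ≤ 3 * a → |dist (y j) (y k) - dist (Z j) (Z k)| ≤ a / 25) := by
  intro N y i a c s g ha hc1 hsep hfwd hbwd
  exact nearBarlow_patchChart ha hc1 hsep hfwd hbwd

end Summit.AtomisticToContinuum.Crystallization.Theorems.PricedLinkCensusTruncatedCensusGap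

end
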